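import Summits.QuantumFields.YangMills.Theorems.BalabanUVNodesN26AtRecord11
import Literature.MathematicalPhysics.QuantumFieldTheory.Balaban1983to89.Node00.Record13
import Literature.MathematicalPhysics.QuantumFieldTheory.Balaban1983to89.Node00.Record13SepCoPH
import Summits.QuantumFields.YangMills.Theses.BalabanUVNodes
import Summits.QuantumFields.BalabanUV.Gaps.CapSignsConstRoad
import Summits.QuantumFields.BalabanUV.Gaps.D1Residue
import Summits.QuantumFields.YangMills.Theorems.BalabanUVNodesK2Line2SlopeGuardPrice
import Summits.QuantumFields.YangMills.Theorems.BalabanUVNodesK2Line1PrimeRemainderPrice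
import Summits.QuantumFields.YangMills.Theorems.EndpointGivenBR13SepCoPH.Negative.RemNamedJets13FalseOfTwoNormalisations

/-!
# CRIT-1 g3 probe — idea-1 (gen 2) card `threshold-slide-comparison` on crux K2⁷ stmt-QuantumFields-20543
# (`Summit.QuantumFields.YangMills.Theses.BalabanUVNodes.EndpointGivenBR13SepCoPH`)

critic refuter-ym-nodeO-crit-1-g3-0 (unit ym-nodeO-crit-1 gen 3; D-0149 ∕ director-ym №19).  Kernel bookkeeping ONLY, for the verdict sheet
`CRIT-1-threshold-slide-comparison.md`; SELF-CONTAINED EDITION (the farm had not yet built the freshly re-written sketch module at tree rev 3933 — `remote:stale:unbuilt` twice): the card's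
shapes are COPIED VERBATIM from `ThresholdSlideSketch.lean` ed.3 (sha16 68e1dda81f815af8, 485 l.; line numbers given at each copy) into this namespace, so every
statement below is about the card's shapes up to `Iff.rfl`; the by-name twin `Crit1ThresholdSlideProbe.lean` (imports the sketch) carries the identical theorems.  Nothing of Bałaban's is asserted or proved; no `sorry`, no `axiom`, no `instance`.

CONTENT
§1 THE MINIMAL FORM IS THE RIGHT REGISTRATION FORM, AND IT IS UNIQUE UP TO `rfl`-GRADE REPACKING.  The critic's independent minimal shape (TI♭)
   `ThresholdInsensitive13Flat` («for every member `e` and every `η > 0` SOME box `≤ θ.γ` with `|β_θ − β_e| ≤ η` at every scale») and the card's ed.3 (TI-min)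
   `ThresholdCorner13` («… some `δ`, EVERY box `≤ δ, ≤ θ.γ` …») are EQUIVALENT (`flat_iff_corner`, box monotonicity) — two seats converged on the same
   load-bearing content.  What the exponential (TI) `ThresholdInsensitive13` asserts BEYOND it: constants `A, c` UNIFORM in the member and ALL boxes `γ′ ≤ θ.γ`,
   hence (`uniformBound_of_TI`, `exp ≤ 1`) a k-, p-, e-uniform bound on the record's FULL window for every member down to `e → 0⁺` — the regime `γ′ ≫ γ(e) = O(e)`
   ([I] Thm 3 p. 264 «γ depends on all other constants»; `Beta.RemainderChain` R16 `γ² ≤ γ₂ε₁²∕(80κ)`) where print has no inductive description of the member.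
   The junction never touches that regime.  The minimal form also suffices in the card's ed.1 (v₀-pinned) registration: `EndpointGivenBR13SepCoPH_of_thresholdSlideFlatP`.
§2 SAME-WALL SANDWICH (what the new pair IS relative to K2⁷'s (D4) wall).  W(θ) := every-slope shadowing of the record's β by the named numbers on small boxes
   (`∃ κ, ShadowN F κ θ hP`).  (a) (TI-min) ∧ (FFᴺ) ⟹ W — the sketch's `shadowN_of_corner`; (b) W ⟹ (FFᴺ) with the member `e := θ.ε₂₉` ITSELF
   (`frozenFamilyNamedJets13_of_shadow`): (FFᴺ) is WEAKER than the wall; (c) W at the record AND at every member (`ShadowAllMembersN`) ⟹ (TI-min)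
   (`corner_of_shadow_allMembers`).  So W(θ) ⟸ (TI-min) ∧ (FFᴺ) ⟸ W(θ) ∧ ∀e W(e): the pair FACTORS the wall through a second threshold; (TI-min) is the
   wall's TRANSFER along the threshold family — not a restatement BY NAME (no registered stub mentions a second threshold), not logically below the wall
   either; the card's «why easier» lives in HOW (TI) would be proved (Gaussian annulus source + fading memory of a DIFFERENCE flow), not in logical strength.
   (d) W is BELOW line 1′'s g-proportional currency, normalisation carried: `shadowN_of_boxRemainder` (`|β − θ.cβ·β⁰_κ| ≤ C_r·p_k` on a box ⟹ W).
HONEST FRAMING: K2⁷ OPEN; the YM mass gap (Clay) is NOT proved by any of this; route R4 closes only the conditional finite-𝕋⁴ rung `BalabanLadder.UV`;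
[I] Thm 2 ∕ (0.31) p. 259 unproved in print; (TI) ∕ (TI-min) NOT PRINTED.
-/

noncomputable section

namespace Summit.QuantumFields.YangMills.Cruxes.EndpointGivenBR13SepCoPH.Crit1ThresholdSlideSA

open Literature.MathematicalPhysics.QuantumFieldTheory.Balaban1983to89
open Literature.MathematicalPhysics.QuantumFieldTheory.Balaban1983to89.FlowStep
open Literature.MathematicalPhysics.QuantumFieldTheory.Balaban1983to89.T4Continuum (T4Family)
open Literature.MathematicalPhysics.QuantumFieldTheory.Balaban1983to89.Node00
open Literature.MathematicalPhysics.QuantumFieldTheory.Balaban1983to89.Beta.OneStepKernelFamily (TbalOf)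
open Literature.MathematicalPhysics.QuantumFieldTheory.Balaban1983to89.Beta.OneStepResolventKernel (JetData)
open Literature.MathematicalPhysics.QuantumFieldTheory.Balaban1983to89.Beta.Drift (OneLoopDrift)
open Summit.QuantumFields.BalabanUV.Gaps
open scoped Matrix.Norms.L2Operator
open Summit.QuantumFields.YangMills.Theorems.EndpointGivenBR13SepCoPH.Negative.RemNamedJets13FalseOfTwoNormalisations (oneLoopDrift_const_mul)
open Summit.QuantumFields.YangMills.Theorems.BalabanUVNodesK2JsOfRecord (StepColourData beta0OfJs BoxRemainder)
open Summit.QuantumFields.YangMills.Theorems.BalabanUVNodesK2Line1PrimeRemainderPrice (endpointExistence_of_drift_constRemainder)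

/-! ## §0 VERBATIM COPIES of the card's shapes (sketch ed.3 `ThresholdSlideSketch.lean`, attribution: that file's text; line numbers of the original) -/

/-- copy of sketch :77 `exp_neg_le_one_div`. [folklore] -/
theorem exp_neg_le_one_div {x : ℝ} (hx : 0 < x) : Real.exp (-x) ≤ 1 / x := by
  rw [Real.exp_neg, one_div]
  exact inv_anti₀ hx ((le_add_of_nonneg_right zero_le_one).trans (Real.add_one_le_exp x))

/-- copy of sketch :129 `betaAt` — the record's merged β read at threshold letter `e`. [cite: Balaban1987RG1, (2.9) p.266] -/
def betaAt (F : T4Family) (θ : Node00.Stage13HParams F 2) (e : ℝ) : HBeta :=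
  letI := θ.instVβ₁; letI := θ.instVβ₂; letI := θ.instιβ
  betaMerged F (mergedTermFamilyMatT F 2 (TcanOfRecord F 2) (chiFixed29 F 2 θ.ν e) θ.εbg) θ.ρ8 θ.bV

/-- copy of sketch :163 `ContRecord13` (= v3 `stub_cont13`'s text). -/
def ContRecord13 : Prop :=
  ∀ (F : T4Family) (θ : Node00.Stage13HParams F 2) (hP : θ.Provisos₁₃SepCoPH F 2), θ.Admissible F 2 →
    letI := θ.instVβ₁; letI := θ.instVβ₂; letI := θ.instιβ
    BetaContH θ.γ
      (betaOfMerged (betaMerged F (mergedTermFamilyMatT F 2 (TcanOfRecord F 2) (chiFixed29 F 2 θ.ν θ.ε₂₉) θ.εbg) θ.ρ8 θ.bV)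
        (beta0OfMerged (betaMerged F (mergedTermFamilyMatT F 2 (TcanOfRecord F 2) (chiFixed29 F 2 θ.ν θ.ε₂₉) θ.εbg) θ.ρ8 θ.bV) θ.v₀) θ.γ)

/-- copy of sketch :174 `D1AtRecord13Pos` (= v3 `stub_d1ResiduePos13`'s text). -/
def D1AtRecord13Pos : Prop :=
  ∀ (F : T4Family) (θ : Node00.Stage13HParams F 2) (hP : θ.Provisos₁₃SepCoPH F 2), θ.Admissible F 2 →
    letI := θ.instVβ₁; letI := θ.instVβ₂; letI := θ.instιβ
    ∃ (Lc : ℕ) (_ : NeZero Lc) (Js : ℕ → JetData 3 Lc) (Nc : ℝ),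
      0 < B12Normalization.stepBal Nc Lc ∧
      (∀ j, beta0OfMerged (betaMerged F (mergedTermFamilyMatT F 2 (TcanOfRecord F 2) (chiFixed29 F 2 θ.ν θ.ε₂₉) θ.εbg) θ.ρ8 θ.bV) θ.v₀ j =
          B12Beta.secondMoment (TbalOf Lc Js j) 0 1) ∧
      D1Residue.Residue Lc Js Nc 0 1

/-- copy of sketch :191 (TI) `ThresholdInsensitive13`. -/
def ThresholdInsensitive13 : Prop :=
  ∀ (F : T4Family) (θ : Node00.Stage13HParams F 2) (hP : θ.Provisos₁₃SepCoPH F 2), θ.Admissible F 2 →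
    ∃ A c : ℝ, 0 < A ∧ 0 < c ∧ ∀ e : ℝ, 0 < e → e ≤ θ.ε₂₉ → ∀ γ' : ℝ, 0 < γ' → γ' ≤ θ.γ →
      ∀ (k : ℕ) (p : Fin (k + 1) → ℝ), p ∈ B12Beta.HistBox γ' k →
        |betaAt F θ θ.ε₂₉ k p - betaAt F θ e k p| ≤ A * Real.exp (-(c * (e / γ') ^ 2))

/-- copy of sketch :202 (FF) `FrozenFamilyOfD1Record13` (ed.1, v₀-pinned). -/
def FrozenFamilyOfD1Record13 : Prop :=
  ∀ (F : T4Family) (θ : Node00.Stage13HParams F 2) (hP : θ.Provisos₁₃SepCoPH F 2), θ.Admissible F 2 →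
    letI := θ.instVβ₁; letI := θ.instVβ₂; letI := θ.instιβ
    ∀ (Lc : ℕ) (_ : NeZero Lc) (Js : ℕ → JetData 3 Lc) (Nc : ℝ),
      (∀ j, beta0OfMerged (betaMerged F (mergedTermFamilyMatT F 2 (TcanOfRecord F 2) (chiFixed29 F 2 θ.ν θ.ε₂₉) θ.εbg) θ.ρ8 θ.bV) θ.v₀ j =
          B12Beta.secondMoment (TbalOf Lc Js j) 0 1) →
      D1Residue.Residue Lc Js Nc 0 1 →
      ∀ r : ℝ, 0 < r → ∃ e : ℝ, 0 < e ∧ e ≤ θ.ε₂₉ ∧ ∃ γe : ℝ, 0 < γe ∧ γe ≤ θ.γ ∧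
        ∀ (k : ℕ) (p : Fin (k + 1) → ℝ), p ∈ B12Beta.HistBox γe k →
          |betaAt F θ e k p - B12Beta.secondMoment (TbalOf Lc Js k) 0 1| ≤ r

/-- copy of sketch :289 `ShadowN` (the every-slope shadowing package by named numbers). -/
def ShadowN (F : T4Family) (κ : StepColourData) (θ : Node00.Stage13HParams F 2) (hP : θ.Provisos₁₃SepCoPH F 2) : Prop :=
  ∀ s : ℝ, 0 < s → ∃ γ₀ : ℝ, 0 < γ₀ ∧ γ₀ ≤ θ.γ ∧
    ∀ (k : ℕ) (p : Fin (k + 1) → ℝ), p ∈ B12Beta.HistBox γ₀ k →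
      |(Node00.datumOfRecord₁₃SepCoPH F 2 θ hP).βfun k p - θ.cβ * beta0OfJs F κ k| ≤ s

/-- copy of sketch :298 (FFᴺ) `FrozenFamilyNamedJets13`. -/
def FrozenFamilyNamedJets13 : Prop :=
  ∀ (F : T4Family) (θ : Node00.Stage13HParams F 2) (hP : θ.Provisos₁₃SepCoPH F 2), θ.Admissible F 2 →
    ∃ κ : StepColourData, ∀ r : ℝ, 0 < r → ∃ e : ℝ, 0 < e ∧ e ≤ θ.ε₂₉ ∧ ∃ γe : ℝ, 0 < γe ∧ γe ≤ θ.γ ∧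
      ∀ (k : ℕ) (p : Fin (k + 1) → ℝ), p ∈ B12Beta.HistBox γe k →
        |betaAt F θ e k p - θ.cβ * beta0OfJs F κ k| ≤ r

/-- copy of sketch :307 (D1ᴺ) `D1AtNEverySlopeJets`. -/
def D1AtNEverySlopeJets : Prop :=
  ∀ (F : T4Family) (κ : StepColourData) (θ : Node00.Stage13HParams F 2) (hP : θ.Provisos₁₃SepCoPH F 2), θ.Admissible F 2 →
    ShadowN F κ θ hP → ∃ A : ℝ, OneLoopDrift (B12Normalization.stepBal 2 F.L) A (beta0OfJs F κ)

/-- copy of sketch :313 (U) `UpperRecord13`. -/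
def UpperRecord13 : Prop :=
  ∀ (F : T4Family) (θ : Node00.Stage13HParams F 2) (hP : θ.Provisos₁₃SepCoPH F 2), θ.Admissible F 2 →
    ∃ β' : ℝ, 0 ≤ β' ∧ BetaUpperH β' θ.γ (Node00.datumOfRecord₁₃SepCoPH F 2 θ hP).βfun

/-- copy of sketch :396 (TI-min) `ThresholdCorner13` (§7, the card's minimal registration form, ed.3∕card ed.6). -/
def ThresholdCorner13 : Prop :=
  ∀ (F : T4Family) (θ : Node00.Stage13HParams F 2) (hP : θ.Provisos₁₃SepCoPH F 2), θ.Admissible F 2 →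
    ∀ e : ℝ, 0 < e → e ≤ θ.ε₂₉ → ∀ η : ℝ, 0 < η → ∃ δ : ℝ, 0 < δ ∧ ∀ γ' : ℝ, 0 < γ' → γ' ≤ δ → γ' ≤ θ.γ →
      ∀ (k : ℕ) (p : Fin (k + 1) → ℝ), p ∈ B12Beta.HistBox γ' k → |betaAt F θ θ.ε₂₉ k p - betaAt F θ e k p| ≤ η

/-- copy of sketch :402 `thresholdCorner_of_insensitive` ((TI) ⟹ (TI-min)). [folklore] -/
theorem thresholdCorner_of_insensitive (h : ThresholdInsensitive13) : ThresholdCorner13 := by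
  intro F θ hP hθ e he heε η hη
  obtain ⟨A, c, hA, hc, hTI⟩ := h F θ hP hθ
  set t : ℝ := min 1 (η * c / A) with ht
  have ht0 : 0 < t := lt_min one_pos (by positivity)
  have ht1 : t ≤ 1 := min_le_left _ _
  have htA : t ≤ η * c / A := min_le_right _ _
  refine ⟨e * t, by positivity, fun γ' hγ' hγ'δ hγ'γ k p hp => ?_⟩
  have h1 := hTI e he heε γ' hγ' hγ'γ k p hp
  have hx : 0 < c * (e / γ') ^ 2 := by positivity
  have hexp : Real.exp (-(c * (e / γ') ^ 2)) ≤ 1 / (c * (e / γ') ^ 2) := exp_neg_le_one_div hx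
  have hrew : 1 / (c * (e / γ') ^ 2) = γ' ^ 2 / (c * e ^ 2) := by
    field_simp
  have hsq : γ' ^ 2 ≤ e ^ 2 * t := by
    calc γ' ^ 2 ≤ (e * t) ^ 2 := by gcongr
      _ = e ^ 2 * (t * t) := by ring
      _ ≤ e ^ 2 * (t * 1) := by gcongr
      _ = e ^ 2 * t := by ring
  have h3 : A * Real.exp (-(c * (e / γ') ^ 2)) ≤ η := by
    calc A * Real.exp (-(c * (e / γ') ^ 2)) ≤ A * (γ' ^ 2 / (c * e ^ 2)) :=
          mul_le_mul_of_nonneg_left (hexp.trans_eq hrew) hA.le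
      _ ≤ A * (e ^ 2 * t / (c * e ^ 2)) := by gcongr
      _ = A * t / c := by field_simp
      _ ≤ A * (η * c / A) / c := by gcongr
      _ = η := by field_simp
  exact h1.trans h3

/-! ## §1 The minimal load-bearing shape: (TI♭) ≡ the card's (TI-min) `ThresholdCorner13`; the exponential (TI)'s over-reach -/

/-- **(TI♭)** — the critic's independent minimal form of the comparison: at every admissible tuple, for every member `0 < e ≤ θ.ε₂₉` and every `η > 0`,
SOME box `]0,γ̄] ⊆ ]0,θ.γ]` on which `|β_θ − β_e| ≤ η` at every scale (constants free in `e`, no rate).  A hypothesis SHAPE, never a fact; NOT PRINTED. -/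
def ThresholdInsensitive13Flat : Prop :=
  ∀ (F : T4Family) (θ : Node00.Stage13HParams F 2) (hP : θ.Provisos₁₃SepCoPH F 2), θ.Admissible F 2 →
    ∀ e : ℝ, 0 < e → e ≤ θ.ε₂₉ → ∀ η : ℝ, 0 < η → ∃ γb : ℝ, 0 < γb ∧ γb ≤ θ.γ ∧
      ∀ (k : ℕ) (p : Fin (k + 1) → ℝ), p ∈ B12Beta.HistBox γb k →
        |betaAt F θ θ.ε₂₉ k p - betaAt F θ e k p| ≤ η

/-- **(TI♭) ↔ (TI-min)**: the critic's and the card's (ed.3 §7) minimal forms coincide (box monotonicity; `γ̄ := min δ θ.γ`, resp. `δ := γ̄`). [folklore] -/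
theorem flat_iff_corner : ThresholdInsensitive13Flat ↔ ThresholdCorner13 := by
  constructor
  · intro h F θ hP hθ e he heε η hη
    obtain ⟨γb, hγb, _, hb⟩ := h F θ hP hθ e he heε η hη
    exact ⟨γb, hγb, fun γ' _ hγ'δ _ k p hp => hb k p fun i => ⟨(hp i).1, (hp i).2.trans hγ'δ⟩⟩
  · intro h F θ hP hθ e he heε η hη
    obtain ⟨δ, hδ, hb⟩ := h F θ hP hθ e he heε η hη
    have hγ : 0 < θ.γ := hθ.toStage9.gamma_pos
    exact ⟨min δ θ.γ, lt_min hδ hγ, min_le_right _ _, fun k p hp => hb _ (lt_min hδ hγ) (min_le_left _ _) (min_le_right _ _) k p hp⟩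

/-- the exponential (TI) implies (TI♭) (through the sketch's `thresholdCorner_of_insensitive`). [folklore] -/
theorem flat_of_TI (hT : ThresholdInsensitive13) : ThresholdInsensitive13Flat :=
  flat_iff_corner.mpr (thresholdCorner_of_insensitive hT)

/-- **What (TI) asserts BEYOND the junction's needs**: a k-, p-, e-UNIFORM bound on the record's FULL window `]0,θ.γ]` for EVERY member down to `e → 0⁺`
(`exp ≤ 1`).  Displayed to make the over-reach of the e-uniform constants + full-window range visible; (TI♭)∕(TI-min) assert no such thing. [folklore] -/
theorem uniformBound_of_TI (hT : ThresholdInsensitive13) (F : T4Family) (θ : Node00.Stage13HParams F 2) (hP : θ.Provisos₁₃SepCoPH F 2)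
    (hθ : θ.Admissible F 2) :
    ∃ A : ℝ, ∀ e : ℝ, 0 < e → e ≤ θ.ε₂₉ → ∀ (k : ℕ) (p : Fin (k + 1) → ℝ), p ∈ B12Beta.HistBox θ.γ k →
      |betaAt F θ θ.ε₂₉ k p - betaAt F θ e k p| ≤ A := by
  obtain ⟨A, c, hA, hc, h⟩ := hT F θ hP hθ
  refine ⟨A, fun e he heε k p hp => (h e he heε θ.γ hθ.toStage9.gamma_pos le_rfl k p hp).trans ?_⟩
  have h1 : Real.exp (-(c * (e / θ.γ) ^ 2)) ≤ 1 := by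
    rw [Real.exp_le_one_iff]
    have : 0 ≤ c * (e / θ.γ) ^ 2 := by positivity
    linarith
  calc A * Real.exp (-(c * (e / θ.γ) ^ 2)) ≤ A * 1 := mul_le_mul_of_nonneg_left h1 hA.le
    _ = A := mul_one A

/-- (TI), (TI♭), (TI-min) are TRIVIAL at the record member `e := θ.ε₂₉` (difference `0`): the whole content is off the record. [folklore] -/
theorem TI_trivial_at_record (F : T4Family) (θ : Node00.Stage13HParams F 2) (k : ℕ) (p : Fin (k + 1) → ℝ) {η : ℝ} (hη : 0 ≤ η) :
    |betaAt F θ θ.ε₂₉ k p - betaAt F θ θ.ε₂₉ k p| ≤ η := by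
  simp [hη]

/-- **THE FLAT JUNCTION** (generic; = the sketch's `slide_junction_min` in the ∃-box packing): (TI♭)-shape + (FF)-shape ⟹ every-slope smallness
(`r := s∕2`, member `e`, `η := s∕2`, `γ₀ := min γ_e γ̄`). [folklore] -/
theorem slide_junction_flat {β : HBeta} {βe : ℝ → HBeta} {b : ℕ → ℝ} {ε γ : ℝ}
    (hTI : ∀ e : ℝ, 0 < e → e ≤ ε → ∀ η : ℝ, 0 < η → ∃ γb : ℝ, 0 < γb ∧ γb ≤ γ ∧
      ∀ (k : ℕ) (p : Fin (k + 1) → ℝ), p ∈ B12Beta.HistBox γb k → |β k p - βe e k p| ≤ η)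
    (hFF : ∀ r : ℝ, 0 < r → ∃ e : ℝ, 0 < e ∧ e ≤ ε ∧ ∃ γe : ℝ, 0 < γe ∧ γe ≤ γ ∧
      ∀ (k : ℕ) (p : Fin (k + 1) → ℝ), p ∈ B12Beta.HistBox γe k → |βe e k p - b k| ≤ r) :
    ∀ s : ℝ, 0 < s → ∃ γ₀ : ℝ, 0 < γ₀ ∧ γ₀ ≤ γ ∧
      ∀ (k : ℕ) (p : Fin (k + 1) → ℝ), p ∈ B12Beta.HistBox γ₀ k → |β k p - b k| ≤ s := by
  intro s hs
  obtain ⟨e, he, heε, γe, hγe, hγeγ, hFFe⟩ := hFF (s / 2) (by positivity)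
  obtain ⟨γb, hγb, _, hTIe⟩ := hTI e he heε (s / 2) (by positivity)
  refine ⟨min γe γb, lt_min hγe hγb, (min_le_left _ _).trans hγeγ, fun k p hp => ?_⟩
  have hpe : p ∈ B12Beta.HistBox γe k := fun i => ⟨(hp i).1, (hp i).2.trans (min_le_left _ _)⟩
  have hpb : p ∈ B12Beta.HistBox γb k := fun i => ⟨(hp i).1, (hp i).2.trans (min_le_right _ _)⟩
  calc |β k p - b k| ≤ |β k p - βe e k p| + |βe e k p - b k| := abs_sub_le _ _ _
    _ ≤ s / 2 + s / 2 := add_le_add (hTIe k p hpb) (hFFe k p hpe)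
    _ = s := by ring

/-- **ed.1 (v₀-pinned) composition FROM THE MINIMAL FORM** (kernel, no sorry): `D1AtRecord13Pos → (TI♭) → FrozenFamilyOfD1Record13 → ContRecord13 → K2⁷` BY NAME —
the card's `EndpointGivenBR13SepCoPH_of_thresholdSlideP` with (TI) weakened to (TI♭) (the sketch proves the minimal-form composition only in the ed.2 form, `…Nmin`).
[folklore] -/
theorem EndpointGivenBR13SepCoPH_of_thresholdSlideFlatP (h : D1AtRecord13Pos) (hT : ThresholdInsensitive13Flat)
    (hF : FrozenFamilyOfD1Record13) (h₄ : ContRecord13) :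
    Summit.QuantumFields.YangMills.Theses.BalabanUVNodes.EndpointGivenBR13SepCoPH := by
  intro F θ hP _hU hθ _hB _hwin
  letI := θ.instVβ₁; letI := θ.instVβ₂; letI := θ.instιβ
  obtain ⟨Lc, _, Js, Nc, hslope, hβ, h1⟩ := h F θ hP hθ
  have hFF := hF F θ hP hθ Lc inferInstance Js Nc hβ h1
  obtain ⟨γ₀, hγ₀, hγ₀le, hsmall⟩ :=
    slide_junction_flat (β := betaAt F θ θ.ε₂₉) (βe := betaAt F θ) (b := fun k => B12Beta.secondMoment (TbalOf Lc Js k) 0 1)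
      (fun e he heε η hη => hT F θ hP hθ e he heε η hη) hFF _ hslope
  have hcont := h₄ F θ hP hθ
  refine D1Residue.endpointExistence_of_residue (Node00.datumOfRecord₁₃SepCoPH F 2 θ hP).fwd
    (oneLoopSplit_betaOfMerged _ _ _) Js (fun j => hβ j) h1 hγ₀ (fun k p hp => ?_) le_rfl
    (fun k => (hcont k).mono (box_mono hγ₀le k))
  have hpbox : p ∈ Box θ.γ k := mem_box.mpr fun i => ⟨(hp i).1, (hp i).2.trans hγ₀le⟩
  show |(Box θ.γ k).indicator (fun w => betaMerged F (mergedTermFamilyMatT F 2 (TcanOfRecord F 2) (chiFixed29 F 2 θ.ν θ.ε₂₉) θ.εbg) θ.ρ8 θ.bV k w -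
      beta0OfMerged (betaMerged F (mergedTermFamilyMatT F 2 (TcanOfRecord F 2) (chiFixed29 F 2 θ.ν θ.ε₂₉) θ.εbg) θ.ρ8 θ.bV) θ.v₀ k) p| ≤ _
  rw [Set.indicator_of_mem hpbox, hβ k]
  exact hsmall k p hp

/-- **(TI♭) ∘ (FFᴺ) ⟹ the every-slope shadowing package `ShadowN`** (the sketch's `shadowN_of_slide`∕`shadowN_of_corner` with the minimal form). [folklore] -/
theorem shadowN_of_slideFlat (hT : ThresholdInsensitive13Flat) (hF : FrozenFamilyNamedJets13)
    (F : T4Family) (θ : Node00.Stage13HParams F 2) (hP : θ.Provisos₁₃SepCoPH F 2) (hθ : θ.Admissible F 2) :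
    ∃ κ : StepColourData, ShadowN F κ θ hP := by
  obtain ⟨κ, hFF⟩ := hF F θ hP hθ
  refine ⟨κ, fun s hs => ?_⟩
  obtain ⟨γ₀, hγ₀, hγ₀le, hsmall⟩ :=
    slide_junction_flat (β := betaAt F θ θ.ε₂₉) (βe := betaAt F θ) (b := fun k => θ.cβ * beta0OfJs F κ k)
      (fun e he heε η hη => hT F θ hP hθ e he heε η hη) hFF s hs
  refine ⟨γ₀, hγ₀, hγ₀le, fun k p hp => ?_⟩
  have hpbox : p ∈ Box θ.γ k := mem_box.mpr fun i => ⟨(hp i).1, (hp i).2.trans hγ₀le⟩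
  letI := θ.instVβ₁; letI := θ.instVβ₂; letI := θ.instιβ
  have e : (Node00.datumOfRecord₁₃SepCoPH F 2 θ hP).βfun k p = betaAt F θ θ.ε₂₉ k p :=
    Node00.betaOfMerged_of_mem _ _ _ hpbox
  rw [e]
  exact hsmall k p hp

/-- **ed.2∕3 (named numbers, split-free) composition FROM THE MINIMAL FORM** (kernel, no sorry):
`D1AtNEverySlopeJets → (TI♭) → FrozenFamilyNamedJets13 → ContRecord13 → UpperRecord13 → K2⁷` BY NAME (= the sketch's `…_of_thresholdSlideNmin` up to `flat_iff_corner`;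
slope `θ.cβ·stepBal 2 F.L > 0`, END = an4's `endpointExistence_of_drift_constRemainder`, drift rescaled by CRIT-1 g2's landed `oneLoopDrift_const_mul`). [folklore] -/
theorem EndpointGivenBR13SepCoPH_of_thresholdSlideFlatN (h₁ : D1AtNEverySlopeJets) (hT : ThresholdInsensitive13Flat) (hF : FrozenFamilyNamedJets13)
    (h₄ : ContRecord13) (h₅ : UpperRecord13) :
    Summit.QuantumFields.YangMills.Theses.BalabanUVNodes.EndpointGivenBR13SepCoPH := by
  intro F θ hP _hU hθ _hB _hwin
  obtain ⟨κ, hS⟩ := shadowN_of_slideFlat hT hF F θ hP hθ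
  obtain ⟨A, hdrift⟩ := h₁ F κ θ hP hθ hS
  have hcβ : 0 < θ.cβ := hθ.toStage9.chart.1
  have hstep : 0 < B12Normalization.stepBal 2 (F.L : ℝ) := B12Normalization.stepBal_pos (by norm_num) (by exact_mod_cast F.hL.2)
  have hs : 0 < θ.cβ * B12Normalization.stepBal 2 F.L := mul_pos hcβ hstep
  obtain ⟨γ₀, hγ₀, hγ₀le, hrem⟩ := hS _ hs
  obtain ⟨β', hβ', hup⟩ := h₅ F θ hP hθ
  have hcont := h₄ F θ hP hθ
  have hdrift' := oneLoopDrift_const_mul hdrift θ.cβ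
  exact endpointExistence_of_drift_constRemainder (Node00.datumOfRecord₁₃SepCoPH F 2 θ hP).fwd hγ₀ hdrift' hrem le_rfl hβ'
    (fun k => (hcont k).mono (box_mono hγ₀le k)) (fun k v hv => hup k v (box_mono hγ₀le k hv))

/-- the card's minimal-form composition, re-derived: `D1AtNEverySlopeJets → ThresholdCorner13 → FrozenFamilyNamedJets13 → ContRecord13 → UpperRecord13 → K2⁷`. [folklore] -/
theorem EndpointGivenBR13SepCoPH_of_thresholdSlideNmin' (h₁ : D1AtNEverySlopeJets) (hT : ThresholdCorner13) (hF : FrozenFamilyNamedJets13)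
    (h₄ : ContRecord13) (h₅ : UpperRecord13) :
    Summit.QuantumFields.YangMills.Theses.BalabanUVNodes.EndpointGivenBR13SepCoPH :=
  EndpointGivenBR13SepCoPH_of_thresholdSlideFlatN h₁ (flat_iff_corner.mpr hT) hF h₄ h₅

/-! ## §2 The same-wall sandwich: {(TI-min), (FFᴺ)} FACTORS the every-slope wall W at the record -/

/-- **W ⟹ (FFᴺ) with the member `e := θ.ε₂₉` itself**: every-slope shadowing at the record already gives the frozen-family stub (the record IS a member,
`betaAt F θ θ.ε₂₉` is its β on the box, `betaOfMerged_of_mem`).  (FFᴺ) is therefore WEAKER than the wall, as a stub should be. [folklore] -/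
theorem frozenFamilyNamedJets13_of_shadow
    (hW : ∀ (F : T4Family) (θ : Node00.Stage13HParams F 2) (hP : θ.Provisos₁₃SepCoPH F 2), θ.Admissible F 2 → ∃ κ : StepColourData, ShadowN F κ θ hP) :
    FrozenFamilyNamedJets13 := by
  intro F θ hP hθ
  obtain ⟨κ, hS⟩ := hW F θ hP hθ
  refine ⟨κ, fun r hr => ⟨θ.ε₂₉, hθ.ε₂₉_pos, le_rfl, ?_⟩⟩
  obtain ⟨γ₀, hγ₀, hγ₀le, h⟩ := hS r hr
  refine ⟨γ₀, hγ₀, hγ₀le, fun k p hp => ?_⟩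
  have hpbox : p ∈ Box θ.γ k := mem_box.mpr fun i => ⟨(hp i).1, (hp i).2.trans hγ₀le⟩
  letI := θ.instVβ₁; letI := θ.instVβ₂; letI := θ.instιβ
  have e : (Node00.datumOfRecord₁₃SepCoPH F 2 θ hP).βfun k p = betaAt F θ θ.ε₂₉ k p :=
    Node00.betaOfMerged_of_mem _ _ _ hpbox
  have := h k p hp
  rwa [e] at this

/-- Every-slope shadowing of the record AND OF EVERY MEMBER of its threshold family by the same named numbers (the wall read at the members — believed exactly
as much as at the record, equally unprinted; NOT a stub of the card, displayed for the sandwich only). -/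
def ShadowAllMembersN : Prop :=
  ∀ (F : T4Family) (θ : Node00.Stage13HParams F 2) (hP : θ.Provisos₁₃SepCoPH F 2), θ.Admissible F 2 →
    ∃ κ : StepColourData, ShadowN F κ θ hP ∧
      ∀ e : ℝ, 0 < e → e ≤ θ.ε₂₉ → ∀ s : ℝ, 0 < s → ∃ γ₀ : ℝ, 0 < γ₀ ∧ γ₀ ≤ θ.γ ∧
        ∀ (k : ℕ) (p : Fin (k + 1) → ℝ), p ∈ B12Beta.HistBox γ₀ k → |betaAt F θ e k p - θ.cβ * beta0OfJs F κ k| ≤ s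

/-- **W at the record AND at the members ⟹ (TI♭)** (triangle inequality through the common named numbers). [folklore] -/
theorem flat_of_shadow_allMembers (hW : ShadowAllMembersN) : ThresholdInsensitive13Flat := by
  intro F θ hP hθ e he heε η hη
  obtain ⟨κ, hS, hmem⟩ := hW F θ hP hθ
  obtain ⟨γ₁, hγ₁, hγ₁le, h₁⟩ := hS (η / 2) (by positivity)
  obtain ⟨γ₂, hγ₂, hγ₂le, h₂⟩ := hmem e he heε (η / 2) (by positivity)
  refine ⟨min γ₁ γ₂, lt_min hγ₁ hγ₂, (min_le_left _ _).trans hγ₁le, fun k p hp => ?_⟩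
  have hp1 : p ∈ B12Beta.HistBox γ₁ k := fun i => ⟨(hp i).1, (hp i).2.trans (min_le_left _ _)⟩
  have hp2 : p ∈ B12Beta.HistBox γ₂ k := fun i => ⟨(hp i).1, (hp i).2.trans (min_le_right _ _)⟩
  have hpbox : p ∈ Box θ.γ k := mem_box.mpr fun i => ⟨(hp i).1, (hp i).2.trans ((min_le_left _ _).trans hγ₁le)⟩
  letI := θ.instVβ₁; letI := θ.instVβ₂; letI := θ.instιβ
  have eq : (Node00.datumOfRecord₁₃SepCoPH F 2 θ hP).βfun k p = betaAt F θ θ.ε₂₉ k p :=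
    Node00.betaOfMerged_of_mem _ _ _ hpbox
  have a := h₁ k p hp1
  rw [eq] at a
  have b := h₂ k p hp2
  calc |betaAt F θ θ.ε₂₉ k p - betaAt F θ e k p|
      ≤ |betaAt F θ θ.ε₂₉ k p - θ.cβ * beta0OfJs F κ k| + |θ.cβ * beta0OfJs F κ k - betaAt F θ e k p| := abs_sub_le _ _ _
    _ ≤ η / 2 + η / 2 := add_le_add a (by rw [abs_sub_comm]; exact b)
    _ = η := by ring

/-- **W at the record and at the members ⟹ the card's (TI-min) `ThresholdCorner13`** — with `shadowN_of_corner` (sketch) and `frozenFamilyNamedJets13_of_shadow`: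
W(θ) ⟸ (TI-min) ∧ (FFᴺ) ⟸ W(θ) ∧ ∀e W(e).  The pair FACTORS the wall through a second threshold. [folklore] -/
theorem corner_of_shadow_allMembers (hW : ShadowAllMembersN) : ThresholdCorner13 :=
  flat_iff_corner.mp (flat_of_shadow_allMembers hW)

/-- **W is BELOW line 1′'s g-proportional currency (normalisation carried)**: a box remainder `|β − θ.cβ·β⁰_κ| ≤ C_r·p_k` on some box `]0,γ₀] ⊆ ]0,θ.γ]`
(DEF-1's `BoxRemainder`, the `RemAt` conjunct of v3's `stub_remNamedJets13` up to the `θ.cβ` factor CRIT-1 g2 showed necessary) gives the every-slope package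
(`γ := min γ₀ (s∕C_r)`).  So the junction's OUTPUT W is not a stronger wall smuggled in. [folklore] -/
theorem shadowN_of_boxRemainder (F : T4Family) (κ : StepColourData) (θ : Node00.Stage13HParams F 2) (hP : θ.Provisos₁₃SepCoPH F 2)
    {Cr γ₀ : ℝ} (hγ₀ : 0 < γ₀) (hγ₀le : γ₀ ≤ θ.γ) (hCr : 0 ≤ Cr)
    (h : BoxRemainder (Node00.datumOfRecord₁₃SepCoPH F 2 θ hP).βfun (fun k => θ.cβ * beta0OfJs F κ k) Cr γ₀) :
    ShadowN F κ θ hP := by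
  intro s hs
  by_cases hC : Cr = 0
  · refine ⟨γ₀, hγ₀, hγ₀le, fun k p hp => (h k p hp).trans ?_⟩
    rw [hC, zero_mul]; exact hs.le
  have hCpos : 0 < Cr := lt_of_le_of_ne hCr (Ne.symm hC)
  refine ⟨min γ₀ (s / Cr), lt_min hγ₀ (by positivity), (min_le_left _ _).trans hγ₀le, fun k p hp => ?_⟩
  have hp0 : p ∈ B12Beta.HistBox γ₀ k := fun i => ⟨(hp i).1, (hp i).2.trans (min_le_left _ _)⟩
  refine (h k p hp0).trans ?_
  have hlast : p (Fin.last k) ≤ s / Cr := (hp (Fin.last k)).2.trans (min_le_right _ _)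
  calc Cr * p (Fin.last k) ≤ Cr * (s / Cr) := mul_le_mul_of_nonneg_left hlast hCr
    _ = s := by field_simp

end Summit.QuantumFields.YangMills.Cruxes.EndpointGivenBR13SepCoPH.Crit1ThresholdSlideSA

end
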